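import Summits.AtomisticToContinuum.HydrodynamicLimit.Theorems.CollisionIsometryCLTDiffuseBackwardInfluencePairCharge
import HarnessLib

/-!
# `DiffuseBackwardInfluence`, line `share-nondegeneracy-one-flight`: THE PAIR-PATH BOUND WITH TAGGED DEFICIT (registered stub
`stub_pairPathBoundT` of skeleton v8; lead c6), 3/3: the per-source extraction (weight at `s < j₀, t ≥ mL − j₀`; split moment at `s ≥ j₀`;
tagged deficit paid by budget + merge mass + `S ×` delayed mass at `s < j₀, t < mL − j₀`) and the source average with the row budget
(crux stmt-AtomisticToContinuum-12950, `--supports`).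
-/

namespace Summit.AtomisticToContinuum.HydrodynamicLimit.Theorems.DiffuseBackwardInfluenceShare

open scoped BigOperators Topology ENNReal InnerProductSpace Classical
open Filter Set MeasureTheory
open Literature.Analysis.FluidPDE (Config HardSphereFlow collidePair)
open Literature.MathematicalPhysics.KineticTheory (localGibbsLaw hsDiameter)
open Summit.AtomisticToContinuum.HydrodynamicLimit.Theorems.DiffuseBackwardInfluenceNeg

noncomputable section

namespace PairPath

section Bound

variable {N : ℕ} {C : OnePath.Src N}

set_option maxHeartbeats 400000 in -- buildfix 2026-08-19: the proof sits at the default budget (~200k measured)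
/-- THE PER-SOURCE BOUND (`K = fin`, box `fin + 2`): the together mass of the two tracers at the end is at most
`2^{j₀−1} ρ₁^{mL∸j₀} + TR/j₀ + (2/S)(BAD + 2·TR) + 2·DEL` with `TR` the total merge mass, `BAD` the budget, `DEL` the delayed re-merge
mass of the source. [folklore] -/
theorem source_boundT (hΔ : 0 < C.Δ) (hpos : 0 < OnePath.fin C) (hm : 1 ≤ C.m) (hL : 1 ≤ C.L) (hη0 : 0 < C.η) (hη1 : C.η < 1)
    {j₀ : ℕ} (hj : 1 ≤ j₀) :
    ∑ i, OnePath.mu C (OnePath.fin C) i ^ 2 ≤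
      (2 : ℝ) ^ (j₀ - 1) * (1 - C.η * (1 - C.η)) ^ (C.m * C.L - j₀) +
      (∑ c ∈ Finset.range (OnePath.fin C), mergeAt C.σ N C.y C.k c) / j₀ +
      (2 / (S C : ℝ)) * (∑ r ∈ Finset.range (S C), ∑ i, budget C r i +
        2 * ∑ c ∈ Finset.range (OnePath.fin C), mergeAt C.σ N C.y C.k c) +
      2 * ∑ r ∈ Finset.Ico 1 (S C), ∑ t ∈ Finset.range (OnePath.nS C (r + 1) - OnePath.nS C r),
        delayedRemAt C.σ N C.y C.k C.Δ (S C) r t := by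
  set F := OnePath.fin C with hF
  set U := F + 2 with hU
  set ρ : ℝ := 1 - C.η * (1 - C.η) with hρ
  set t₀ : ℕ := C.m * C.L - j₀ with ht₀
  set T := Tm C F with hT
  set TR := ∑ c ∈ Finset.range F, mergeAt C.σ N C.y C.k c with hTR
  set BAD := ∑ r ∈ Finset.range (S C), ∑ i, budget C r i with hBAD
  set DEL := ∑ r ∈ Finset.Ico 1 (S C), ∑ t ∈ Finset.range (OnePath.nS C (r + 1) - OnePath.nS C r),
    delayedRemAt C.σ N C.y C.k C.Δ (S C) r t with hDEL
  have hS : 0 < 2 * C.m * C.L := S_pos hm hL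
  have hSR : (S C : ℝ) = 2 * ((C.m * C.L : ℕ) : ℝ) := by unfold S; push_cast; ring
  have hmL : (0 : ℝ) < ((C.m * C.L : ℕ) : ℝ) := by
    have : 0 < C.m * C.L := Nat.mul_pos (by omega) (by omega)
    exact_mod_cast this
  have hSpos : (0 : ℝ) < (S C : ℝ) := by rw [hSR]; linarith
  have hρ0 : 0 < ρ := by rw [hρ]; nlinarith
  have hρ1 : ρ ≤ 1 := by rw [hρ]; nlinarith
  have hρlt : ρ < 1 := by rw [hρ]; nlinarith
  have hj0 : (0 : ℝ) < (j₀ : ℝ) := by exact_mod_cast hj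
  have hcntF : cnt C F = S C := cnt_fin hΔ hpos hm hL
  have hT0 : ∀ i s t, 0 ≤ T i s t := fun i s t => Tm_nonneg _ _ _ _
  have hTR0 : 0 ≤ TR := Finset.sum_nonneg fun c _ => OnePath.mergeAt_src_nonneg (C := C) c
  have htS : ∀ i s t, T i s t ≠ 0 → t ≤ S C := by
    intro i s t hne
    by_contra hlt
    push Not at hlt
    exact hne (Tm_eq_zero_of_resolved_lt F i s (by rw [hcntF]; omega))
  have hM : ∑ i, OnePath.mu C F i ^ 2 = ∑ i, sT U T i :=
    Finset.sum_congr rfl fun i _ => ((marginal (C := C) F F le_rfl).1 i).symm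
  have hW : wT (1 / 2) ρ U T ≤ 1 := by
    have h := weight_le_one hΔ hpos hm hL hη0.le hη1.le F F le_rfl le_rfl
    have hA : 0 ≤ wA (1 / 2) ρ U (S C) (Am C F) := by
      unfold wA
      refine Finset.sum_nonneg fun _ _ => Finset.sum_nonneg fun _ _ => Finset.sum_nonneg fun _ _ =>
        Finset.sum_nonneg fun _ _ => Finset.sum_nonneg fun _ _ => mul_nonneg (mul_nonneg ?_ ?_) (Am_nonneg _ _ _ _ _ _)
      · positivity
      · exact pow_nonneg (inv_nonneg.2 hρ0.le) _
    rw [← hρ, ← hU, ← hT] at h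
    linarith
  have hSMle : smT U T ≤ TR := by
    have h := splitMoment_eq (C := C) F F le_rfl
    have hA : 0 ≤ smA U (S C) (Am C F) := by
      unfold smA
      refine Finset.sum_nonneg fun _ _ => Finset.sum_nonneg fun _ _ => Finset.sum_nonneg fun s _ =>
        Finset.sum_nonneg fun _ _ => Finset.sum_nonneg fun _ _ => ?_
      rcases Nat.eq_zero_or_pos s with hs | hs
      · rw [hs, Am_zero_splits, mul_zero]
      · exact mul_nonneg (by have : (1 : ℝ) ≤ s := (by exact_mod_cast hs); linarith) (Am_nonneg _ _ _ _ _ _)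
    rw [← hU, ← hT, ← hTR] at h
    linarith
  have hSM0 : 0 ≤ smT U T := by
    unfold smT
    exact Finset.sum_nonneg fun _ _ => Finset.sum_nonneg fun s _ => Finset.sum_nonneg fun _ _ =>
      mul_nonneg (Nat.cast_nonneg s) (hT0 _ _ _)
  have hDF : dfT (fun i => (S C : ℝ) - (gap C F i : ℝ)) U T ≤
      ∑ c ∈ Finset.range F, chargeAt C F c + TR + (S C : ℝ) * DEL := by
    have h := deficit_eq (C := C) F F le_rfl
    have hA : 0 ≤ dfA U (S C) (Am C F) := by
      unfold dfA
      refine Finset.sum_nonneg fun _ _ => Finset.sum_nonneg fun _ _ => Finset.sum_nonneg fun _ _ =>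
        Finset.sum_nonneg fun t _ => Finset.sum_nonneg fun g _ => ?_
      rcases Nat.lt_or_ge g t with hgt | hgt
      · rw [Am_eq_zero_of_tag_lt F _ _ _ hgt, mul_zero]
      · exact mul_nonneg (by have : (t : ℝ) ≤ g := (by exact_mod_cast hgt); linarith) (Am_nonneg _ _ _ _ _ _)
    have hcast : (fun i => (cnt C F : ℝ) - (gap C F i : ℝ)) = fun i => (S C : ℝ) - (gap C F i : ℝ) := by
      funext i; rw [hcntF]
    rw [hcast, ← hU, ← hT] at h
    have hlag : ∑ c ∈ Finset.range F, lagAt C F c ≤ TR + (S C : ℝ) * DEL := by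
      calc ∑ c ∈ Finset.range F, lagAt C F c
          ≤ ∑ c ∈ Finset.range F, (mergeAt C.σ N C.y C.k c + (S C : ℝ) * delFlow C F c) :=
            Finset.sum_le_sum fun c hc => lagAt_le (by have := Finset.mem_range.1 hc; omega)
        _ = TR + (S C : ℝ) * ∑ c ∈ Finset.range F, delFlow C F c := by
            rw [Finset.sum_add_distrib, Finset.mul_sum]
        _ ≤ TR + (S C : ℝ) * DEL := by
            have := sum_delFlow_le hΔ hpos hm hL (K := F) le_rfl
            nlinarith [hSpos.le]
    rw [Finset.sum_add_distrib] at h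
    linarith
  have hCH : ∑ c ∈ Finset.range F, chargeAt C F c + ∑ i, (gap C F i : ℝ) * sT U T i ≤ BAD :=
    charges_le_budget hΔ hpos hm hL le_rfl
  have hSt : ∑ i, ∑ s ∈ Finset.range U, ∑ t ∈ Finset.range U, ((S C : ℝ) - (t : ℝ)) * T i s t =
      dfT (fun i => (S C : ℝ) - (gap C F i : ℝ)) U T + ∑ i, (gap C F i : ℝ) * sT U T i := by
    unfold dfT sT
    rw [← Finset.sum_add_distrib]
    refine Finset.sum_congr rfl fun i _ => ?_
    rw [Finset.mul_sum, ← Finset.sum_add_distrib]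
    refine Finset.sum_congr rfl fun s _ => ?_
    rw [Finset.mul_sum, ← Finset.sum_add_distrib]
    refine Finset.sum_congr rfl fun t _ => ?_
    ring
  set c₂ : ℝ := (2 : ℝ) ^ (j₀ - 1) * ρ ^ t₀ with hc₂
  have hc₂0 : 0 ≤ c₂ := by positivity
  have hpt : ∀ i s t, T i s t ≤ (1 / (j₀ : ℝ)) * ((s : ℝ) * T i s t) +
      c₂ * ((1 / 2 : ℝ) ^ s * ρ⁻¹ ^ t * T i s t) + (1 / ((C.m * C.L : ℕ) : ℝ)) * (((S C : ℝ) - (t : ℝ)) * T i s t) := by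
    intro i s t
    set x := T i s t with hx
    have hx0 : 0 ≤ x := hT0 i s t
    by_cases hxz : x = 0
    · rw [hxz]; simp
    have htle : (t : ℝ) ≤ (S C : ℝ) := by exact_mod_cast htS i s t hxz
    have h1 : 0 ≤ (1 / (j₀ : ℝ)) * ((s : ℝ) * x) := by positivity
    have h2 : 0 ≤ c₂ * ((1 / 2 : ℝ) ^ s * ρ⁻¹ ^ t * x) :=
      mul_nonneg hc₂0 (mul_nonneg (mul_nonneg (by positivity) (pow_nonneg (inv_nonneg.2 hρ0.le) _)) hx0)
    have h3 : 0 ≤ (1 / ((C.m * C.L : ℕ) : ℝ)) * (((S C : ℝ) - (t : ℝ)) * x) :=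
      mul_nonneg (by positivity) (mul_nonneg (by linarith) hx0)
    by_cases hs : j₀ ≤ s
    · -- many splits: the split moment pays
      have : x ≤ (1 / (j₀ : ℝ)) * ((s : ℝ) * x) := by
        rw [← mul_assoc, one_div, inv_mul_eq_div]
        have : (1 : ℝ) ≤ (s : ℝ) / (j₀ : ℝ) := by
          rw [le_div_iff₀ hj0, one_mul]; exact_mod_cast hs
        nlinarith
      linarith
    · push Not at hs
      by_cases ht : t₀ ≤ t
      · -- few splits, many scores: the weight pays
        have hw : x ≤ c₂ * ((1 / 2 : ℝ) ^ s * ρ⁻¹ ^ t * x) := by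
          have hA : (1 : ℝ) ≤ (2 : ℝ) ^ (j₀ - 1) * (1 / 2 : ℝ) ^ s := by
            rw [one_div, inv_pow, ← div_eq_mul_inv, le_div_iff₀ (by positivity), one_mul]
            exact pow_le_pow_right₀ (by norm_num) (by omega)
          have hB : (1 : ℝ) ≤ ρ ^ t₀ * ρ⁻¹ ^ t := by
            rw [inv_pow, ← div_eq_mul_inv, le_div_iff₀ (pow_pos hρ0 _), one_mul]
            exact pow_le_pow_of_le_one hρ0.le hρ1 ht
          have hAB : (1 : ℝ) ≤ c₂ * ((1 / 2 : ℝ) ^ s * ρ⁻¹ ^ t) := by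
            rw [hc₂]
            calc (1 : ℝ) ≤ ((2 : ℝ) ^ (j₀ - 1) * (1 / 2 : ℝ) ^ s) * (ρ ^ t₀ * ρ⁻¹ ^ t) :=
                  one_le_mul_of_one_le_of_one_le hA hB
              _ = _ := by ring
          calc x = 1 * x := (one_mul x).symm
            _ ≤ (c₂ * ((1 / 2 : ℝ) ^ s * ρ⁻¹ ^ t)) * x := mul_le_mul_of_nonneg_right hAB hx0
            _ = _ := by ring
        linarith
      · -- few splits, few scores: the deficit pays
        push Not at ht
        have hdef : ((C.m * C.L : ℕ) : ℝ) ≤ (S C : ℝ) - (t : ℝ) := by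
          rw [hSR]
          have : (t : ℝ) + 1 ≤ ((C.m * C.L : ℕ) : ℝ) := by
            have : t + 1 ≤ C.m * C.L := by omega
            exact_mod_cast this
          linarith
        have : x ≤ (1 / ((C.m * C.L : ℕ) : ℝ)) * (((S C : ℝ) - (t : ℝ)) * x) := by
          rw [← mul_assoc, one_div, inv_mul_eq_div]
          have : (1 : ℝ) ≤ ((S C : ℝ) - (t : ℝ)) / ((C.m * C.L : ℕ) : ℝ) := by
            rw [le_div_iff₀ hmL, one_mul]; exact hdef
          nlinarith
        linarith
  have hsum : ∑ i, sT U T i ≤ (1 / (j₀ : ℝ)) * smT U T + c₂ * wT (1 / 2) ρ U T +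
      (1 / ((C.m * C.L : ℕ) : ℝ)) * ∑ i, ∑ s ∈ Finset.range U, ∑ t ∈ Finset.range U, ((S C : ℝ) - (t : ℝ)) * T i s t := by
    unfold sT smT wT
    rw [Finset.mul_sum, Finset.mul_sum, Finset.mul_sum, ← Finset.sum_add_distrib, ← Finset.sum_add_distrib]
    refine Finset.sum_le_sum fun i _ => ?_
    rw [Finset.mul_sum, Finset.mul_sum, Finset.mul_sum, ← Finset.sum_add_distrib, ← Finset.sum_add_distrib]
    refine Finset.sum_le_sum fun s _ => ?_
    rw [Finset.mul_sum, Finset.mul_sum, Finset.mul_sum, ← Finset.sum_add_distrib, ← Finset.sum_add_distrib]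
    exact Finset.sum_le_sum fun t _ => hpt i s t
  rw [hM]
  refine hsum.trans ?_
  rw [hSt]
  have hA1 : (1 / (j₀ : ℝ)) * smT U T ≤ TR / j₀ := by
    rw [one_div, inv_mul_eq_div]; exact div_le_div_of_nonneg_right hSMle hj0.le
  have hA2 : c₂ * wT (1 / 2) ρ U T ≤ (2 : ℝ) ^ (j₀ - 1) * ρ ^ (C.m * C.L - j₀) := by
    calc c₂ * wT (1 / 2) ρ U T ≤ c₂ * 1 := mul_le_mul_of_nonneg_left hW hc₂0
      _ = _ := by rw [mul_one, hc₂]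
  have hA3 : (1 / ((C.m * C.L : ℕ) : ℝ)) * (dfT (fun i => (S C : ℝ) - (gap C F i : ℝ)) U T +
      ∑ i, (gap C F i : ℝ) * sT U T i) ≤ (2 / (S C : ℝ)) * (BAD + 2 * TR) + 2 * DEL := by
    have hinv : 1 / ((C.m * C.L : ℕ) : ℝ) = 2 / (S C : ℝ) := by
      rw [hSR]; field_simp
    rw [hinv]
    have hle : dfT (fun i => (S C : ℝ) - (gap C F i : ℝ)) U T + ∑ i, (gap C F i : ℝ) * sT U T i ≤
        BAD + TR + (S C : ℝ) * DEL := by linarith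
    have hDEL0 : 0 ≤ DEL := Finset.sum_nonneg fun r _ => Finset.sum_nonneg fun t _ => by
      unfold delayedRemAt
      exact Finset.sum_nonneg fun _ _ => Finset.sum_nonneg fun _ _ => Finset.sum_nonneg fun _ _ =>
        mul_nonneg (apF_nonneg (C := C) _ _ _ _) (mul_nonneg (K_nonneg _ _ _) (K_nonneg _ _ _))
    have hTRS : 0 ≤ (2 / (S C : ℝ)) * TR := by positivity
    have hkey : (2 / (S C : ℝ)) * (BAD + TR + (S C : ℝ) * DEL) = (2 / (S C : ℝ)) * (BAD + 2 * TR) + 2 * DEL - (2 / (S C : ℝ)) * TR := by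
      have hS0 : (S C : ℝ) ≠ 0 := hSpos.ne'
      field_simp
      ring
    have hmul := mul_le_mul_of_nonneg_left hle (show (0 : ℝ) ≤ 2 / (S C : ℝ) by positivity)
    rw [hkey] at hmul
    linarith
  have hfin := add_le_add (add_le_add hA1 hA2) hA3
  exact hfin.trans (le_of_eq (by ring))

end Bound

/-! ### §H Averaging over the sources with the row budget -/

section Average

variable {σ : ℝ} {N : ℕ}

/-- The total re-merge fraction is nonnegative. [folklore] -/
theorem totalRemFr_nonneg (σ : ℝ) (N : ℕ) (y : Cfg N) (Δ : ℝ) : 0 ≤ totalRemFr σ N y Δ := by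
  unfold totalRemFr
  refine mul_nonneg (inv_nonneg.2 (Nat.cast_nonneg _)) (Finset.sum_nonneg fun k _ => Finset.sum_nonneg fun c _ => ?_)
  exact OnePath.mergeAt_src_nonneg (C := (⟨σ, y, Δ, 0, 0, 0, k⟩ : OnePath.Src N)) c

/-- The delayed re-merge fraction on the `2mL` grid is the source average of the sources' delayed masses, and is nonnegative. [folklore] -/
theorem delayedRemFr_eq_sum (σ : ℝ) (N : ℕ) (y : Cfg N) (Δ η : ℝ) (m L : ℕ) :
    delayedRemFr σ N y Δ (2 * m * L) = ((N + 1 : ℕ) : ℝ)⁻¹ * ∑ k : Fin (N + 1),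
      ∑ r ∈ Finset.Ico 1 (S (⟨σ, y, Δ, η, m, L, k⟩ : OnePath.Src N)),
        ∑ t ∈ Finset.range (OnePath.nS (⟨σ, y, Δ, η, m, L, k⟩ : OnePath.Src N) (r + 1) -
          OnePath.nS (⟨σ, y, Δ, η, m, L, k⟩ : OnePath.Src N) r),
          delayedRemAt σ N y k Δ (S (⟨σ, y, Δ, η, m, L, k⟩ : OnePath.Src N)) r t := rfl

end Average

end PairPath

/-! ## The stub -/

open PairPath in
/-- **THE PAIR-PATH BOUND WITH TAGGED DEFICIT, PATHWISE** (registered stub `stub_pairPathBoundT` of skeleton v8 of the line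
`share-nondegeneracy-one-flight` of crux `DiffuseBackwardInfluence`): under exact host uniformity (`RowBudgetN`), for every configuration,
window `Δ > 0`, `η ∈ (0,1)`, `m, L, j₀ ≥ 1` and level `b` dominating `idleFr_r + degFr_r` on each of the `2mL` slots,
`ipr ≤ 9 (2^{j₀}(1−η(1−η))^{mL−j₀} + totalRemFr·(1/j₀ + 4/(mL)) + 2/(mL) + 2b + 2·delayedRemFr_{2mL})`.
Proof: `ipr/9` is the source average of the together mass of the two tracers of a source at the end (`ipr_eq_blockMass`, marginal of the
marked process); per source `source_boundT` (supermartingale at `s < j₀, t ≥ mL − j₀`; split moment at `s ≥ j₀`; tagged deficit paid by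
the budget, the merge mass and `S ×` the delayed mass at `s < j₀, t < mL − j₀`); averaging turns the budgets into `Σ_r (idleFr_r + degFr_r)
≤ 2mL·b` (`sum_charge_le`), the merge masses into `totalRemFr` and the delayed masses into `delayedRemFr`. [folklore] -/
theorem stub_pairPathBoundT : ∀ σ : ℝ, RowBudgetN σ → PairPathBoundT σ := by
  intro σ hRB N y Δ hΔ η hη0 hη1 m L j₀ hm hL hj b hb
  have hS : 0 < 2 * m * L := Nat.mul_pos (Nat.mul_pos (by norm_num) hm) hL
  have hN : (0 : ℝ) < ((N + 1 : ℕ) : ℝ) := by positivity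
  have hmL : (0 : ℝ) < ((m * L : ℕ) : ℝ) := by exact_mod_cast Nat.mul_pos hm hL
  have hρ0 : 0 ≤ 1 - η * (1 - η) := by nlinarith
  have hb0 : 0 ≤ b :=
    le_trans (add_nonneg (idleFr_nonneg σ N y Δ _ 0) (degFr_nonneg σ N y Δ _ 0 η)) (hb 0 hS)
  have hTR0 := PairPath.totalRemFr_nonneg σ N y Δ
  have hDR0 : 0 ≤ delayedRemFr σ N y Δ (2 * m * L) := by
    rw [PairPath.delayedRemFr_eq_sum σ N y Δ η m L]
    refine mul_nonneg (inv_nonneg.2 hN.le) (Finset.sum_nonneg fun k _ => Finset.sum_nonneg fun r _ =>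
      Finset.sum_nonneg fun t _ => ?_)
    unfold delayedRemAt
    exact Finset.sum_nonneg fun _ _ => Finset.sum_nonneg fun _ _ => Finset.sum_nonneg fun _ _ =>
      mul_nonneg (PairPath.apF_nonneg (C := (⟨σ, y, Δ, η, m, L, k⟩ : OnePath.Src N)) _ _ _ _)
        (mul_nonneg (PairPath.K_nonneg (C := (⟨σ, y, Δ, η, m, L, k⟩ : OnePath.Src N)) _ _ _)
          (PairPath.K_nonneg (C := (⟨σ, y, Δ, η, m, L, k⟩ : OnePath.Src N)) _ _ _))
  have hgeom0 : 0 ≤ (2 : ℝ) ^ j₀ * (1 - η * (1 - η)) ^ (m * L - j₀) := by positivity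
  by_cases hfin : colls σ N y Δ = 0
  · -- no fold step: `ipr = 9` and the last slot is empty, so `b ≥ 1`
    rw [ipr_eq_nine_of_colls_eq_zero hfin]
    have hidle : idleFr σ N y Δ (2 * m * L) (2 * m * L - 1) = 1 := by
      unfold idleFr
      have hall : (Finset.univ.filter fun i : Fin (N + 1) => IdleOn σ N y Δ (2 * m * L) (2 * m * L - 1) i) =
          Finset.univ := by
        refine Finset.filter_true_of_mem fun i _ => ?_
        intro k _ hk2
        rw [Nat.sub_add_cancel hS, OnePath.slotStart_self hS, hfin] at hk2
        exact absurd hk2 (Nat.not_lt_zero _)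
      rw [hall, Finset.card_univ, Fintype.card_fin]
      exact div_self hN.ne'
    have h1 : 1 ≤ b := by
      have := hb (2 * m * L - 1) (Nat.sub_lt hS Nat.one_pos)
      rw [hidle] at this
      linarith [degFr_nonneg σ N y Δ (2 * m * L) (2 * m * L - 1) η]
    have : 0 ≤ totalRemFr σ N y Δ * (1 / (j₀ : ℝ) + 4 / ((m * L : ℕ) : ℝ)) + 2 / ((m * L : ℕ) : ℝ) := by positivity
    nlinarith
  · have hpos : 0 < colls σ N y Δ := Nat.pos_of_ne_zero hfin
    set C : Fin (N + 1) → OnePath.Src N := fun k => ⟨σ, y, Δ, η, m, L, k⟩ with hC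
    have hsrc : ∀ k : Fin (N + 1), ∑ i, blockMass σ N y (colls σ N y Δ) i k ^ 2 ≤ 9 *
        ((2 : ℝ) ^ (j₀ - 1) * (1 - η * (1 - η)) ^ (m * L - j₀) +
          (∑ c ∈ Finset.range (colls σ N y Δ), mergeAt σ N y k c) / j₀ +
          (2 / ((2 * m * L : ℕ) : ℝ)) * (∑ r ∈ Finset.range (2 * m * L), ∑ i, PairPath.budget (C k) r i +
            2 * ∑ c ∈ Finset.range (colls σ N y Δ), mergeAt σ N y k c) +
          2 * ∑ r ∈ Finset.Ico 1 (2 * m * L), ∑ t ∈ Finset.range (OnePath.nS (C k) (r + 1) - OnePath.nS (C k) r),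
            delayedRemAt σ N y k Δ (2 * m * L) r t) := by
      intro k
      have h := PairPath.source_boundT (C := C k) hΔ hpos hm hL hη0 hη1 hj
      have hmu : ∀ i, blockMass σ N y (colls σ N y Δ) i k ^ 2 = 9 * OnePath.mu (C k) (colls σ N y Δ) i ^ 2 := fun i => by
        simp only [OnePath.mu, hC]; ring
      rw [Finset.sum_congr rfl fun i _ => hmu i, ← Finset.mul_sum]
      have e1 : OnePath.fin (C k) = colls σ N y Δ := rfl
      have e2 : PairPath.S (C k) = 2 * m * L := rfl
      rw [e1, e2] at h
      have : (C k).m * (C k).L = m * L := rfl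
      rw [this] at h
      linarith
    set A : ℝ := (2 : ℝ) ^ (j₀ - 1) * (1 - η * (1 - η)) ^ (m * L - j₀) with hA
    set cS : ℝ := 2 / ((2 * m * L : ℕ) : ℝ) with hcS
    set TRk : Fin (N + 1) → ℝ := fun k => ∑ c ∈ Finset.range (colls σ N y Δ), mergeAt σ N y k c with hTRk
    set BADk : Fin (N + 1) → ℝ := fun k => ∑ r ∈ Finset.range (2 * m * L), ∑ i, PairPath.budget (C k) r i with hBADk
    set DELk : Fin (N + 1) → ℝ := fun k => ∑ r ∈ Finset.Ico 1 (2 * m * L),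
      ∑ t ∈ Finset.range (OnePath.nS (C k) (r + 1) - OnePath.nS (C k) r), delayedRemAt σ N y k Δ (2 * m * L) r t with hDELk
    have hcS0 : 0 ≤ cS := by positivity
    have hj0 : (0 : ℝ) < (j₀ : ℝ) := by exact_mod_cast (lt_of_lt_of_le Nat.zero_lt_one hj)
    have haff : ∀ k : Fin (N + 1), ∑ i, blockMass σ N y (colls σ N y Δ) i k ^ 2 ≤
        9 * A + (9 / (j₀ : ℝ) + 18 * cS) * TRk k + 9 * cS * BADk k + 18 * DELk k := by
      intro k
      have h := hsrc k
      have e : 9 * (A + TRk k / (j₀ : ℝ) + cS * (BADk k + 2 * TRk k) + 2 * DELk k) =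
          9 * A + (9 / (j₀ : ℝ) + 18 * cS) * TRk k + 9 * cS * BADk k + 18 * DELk k := by ring
      rw [← e]; exact h
    have hbud : ∑ k : Fin (N + 1), BADk k ≤ ((N + 1 : ℕ) : ℝ) * ((2 * m * L : ℕ) : ℝ) * b := by
      simp only [hBADk]
      rw [Finset.sum_comm]
      have hr : ∀ r ∈ Finset.range (2 * m * L), ∑ k : Fin (N + 1), ∑ i, PairPath.budget (C k) r i ≤ ((N + 1 : ℕ) : ℝ) * b := by
        intro r hr
        have hr' := Finset.mem_range.1 hr
        calc ∑ k : Fin (N + 1), ∑ i, PairPath.budget (C k) r i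
            ≤ ((N + 1 : ℕ) : ℝ) * (idleFr σ N y Δ (2 * m * L) r + degFr σ N y Δ (2 * m * L) r η) :=
              sum_charge_le hRB y Δ η m L r
          _ ≤ ((N + 1 : ℕ) : ℝ) * b := mul_le_mul_of_nonneg_left (hb r hr') hN.le
      calc ∑ r ∈ Finset.range (2 * m * L), ∑ k : Fin (N + 1), ∑ i, PairPath.budget (C k) r i
          ≤ ∑ _r ∈ Finset.range (2 * m * L), ((N + 1 : ℕ) : ℝ) * b := Finset.sum_le_sum hr
        _ = ((N + 1 : ℕ) : ℝ) * ((2 * m * L : ℕ) : ℝ) * b := by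
            rw [Finset.sum_const, Finset.card_range, nsmul_eq_mul]; push_cast; ring
    have hTReq : ∑ k : Fin (N + 1), TRk k = ((N + 1 : ℕ) : ℝ) * totalRemFr σ N y Δ := by
      simp only [hTRk]; unfold totalRemFr; rw [← mul_assoc, mul_inv_cancel₀ hN.ne', one_mul]
    have hDReq : ∑ k : Fin (N + 1), DELk k = ((N + 1 : ℕ) : ℝ) * delayedRemFr σ N y Δ (2 * m * L) := by
      simp only [hDELk]
      rw [PairPath.delayedRemFr_eq_sum σ N y Δ η m L, ← mul_assoc, mul_inv_cancel₀ hN.ne', one_mul]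
      rfl
    have hsum : ∑ k : Fin (N + 1), ∑ i, blockMass σ N y (colls σ N y Δ) i k ^ 2 ≤
        ((N + 1 : ℕ) : ℝ) * (9 * A) + (9 / (j₀ : ℝ) + 18 * cS) * (((N + 1 : ℕ) : ℝ) * totalRemFr σ N y Δ) +
          9 * cS * (((N + 1 : ℕ) : ℝ) * ((2 * m * L : ℕ) : ℝ) * b) +
          18 * (((N + 1 : ℕ) : ℝ) * delayedRemFr σ N y Δ (2 * m * L)) := by
      calc ∑ k : Fin (N + 1), ∑ i, blockMass σ N y (colls σ N y Δ) i k ^ 2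
          ≤ ∑ k : Fin (N + 1), (9 * A + (9 / (j₀ : ℝ) + 18 * cS) * TRk k + 9 * cS * BADk k + 18 * DELk k) :=
            Finset.sum_le_sum fun k _ => haff k
        _ = ((N + 1 : ℕ) : ℝ) * (9 * A) + (9 / (j₀ : ℝ) + 18 * cS) * ∑ k : Fin (N + 1), TRk k +
              9 * cS * ∑ k : Fin (N + 1), BADk k + 18 * ∑ k : Fin (N + 1), DELk k := by
            rw [Finset.sum_add_distrib, Finset.sum_add_distrib, Finset.sum_add_distrib, Finset.sum_const, Finset.card_univ,
              Fintype.card_fin, nsmul_eq_mul, ← Finset.mul_sum, ← Finset.mul_sum, ← Finset.mul_sum]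
        _ ≤ _ := by
            rw [hTReq, hDReq]
            have := mul_le_mul_of_nonneg_left hbud (show 0 ≤ 9 * cS by positivity)
            linarith
    rw [ipr_eq_blockMass, Finset.sum_comm, inv_mul_le_iff₀ hN]
    refine hsum.trans ?_
    have hSR : ((2 * m * L : ℕ) : ℝ) = 2 * ((m * L : ℕ) : ℝ) := by push_cast; ring
    have hcSeq : cS = 1 / ((m * L : ℕ) : ℝ) := by rw [hcS, hSR]; field_simp
    have h2pow : A ≤ (2 : ℝ) ^ j₀ * (1 - η * (1 - η)) ^ (m * L - j₀) :=
      mul_le_mul_of_nonneg_right (pow_le_pow_right₀ (by norm_num) (Nat.sub_le _ _)) (pow_nonneg hρ0 _)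
    set P : ℝ := ((N + 1 : ℕ) : ℝ) with hP
    set TRf := totalRemFr σ N y Δ with hTRf
    set DRf := delayedRemFr σ N y Δ (2 * m * L) with hDRf
    set q : ℝ := ((m * L : ℕ) : ℝ) with hq
    have hq0 : 0 < q := hmL
    rw [hcSeq, hSR]
    have hPTR : 0 ≤ P * TRf := mul_nonneg hN.le hTR0
    have key : P * (9 * A) + (9 / (j₀ : ℝ) + 18 * (1 / q)) * (P * TRf) + 9 * (1 / q) * (P * (2 * q) * b) + 18 * (P * DRf) =
        P * (9 * (A + TRf * (1 / (j₀ : ℝ) + 2 / q) + 2 * b + 2 * DRf)) := by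
      field_simp
      ring
    rw [key]
    refine mul_le_mul_of_nonneg_left ?_ hN.le
    have : TRf * (1 / (j₀ : ℝ) + 2 / q) ≤ TRf * (1 / (j₀ : ℝ) + 4 / q) :=
      mul_le_mul_of_nonneg_left (by have : 2 / q ≤ 4 / q := div_le_div_of_nonneg_right (by norm_num) hq0.le; linarith) hTR0
    have : 0 ≤ 2 / q := by positivity
    nlinarith [h2pow]

end

end Summit.AtomisticToContinuum.HydrodynamicLimit.Theorems.DiffuseBackwardInfluenceShare
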